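/-
Copyright (c) 2026 the pub-hodgecm-mathlib formalisation cell (harness21).  Prover seat hodgecm-mathlib-K2E4-p10 (g6), Track B ∕ K2-LIT, h413 =
`stmt-HodgeConjecture-24833`, line `K2_E1_TraceFormulaBeta`, campaign «EIS-R7-BL-SPH-3», (RES) letter payer (P-cusp), part 1: the RESIDUE FUNCTION `g ↦ Res_{z=2} Ẽ(z)(g)` of the
continued Eisenstein series on `U(J₃)` — locally uniform bound near the pole, continuity, the Siegel-top formula for `Λ^T Ẽ(z)`, and the identification of the `L²` residue class
(dealer K2E1-plan (g6) (89), 2026-09-04).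
-/
import Summits.HodgeConjecture.HodgeConjecture.Theorems.K2E1SphericalEisensteinResidueOrthogonalU        -- THIS SEAT: brings `supHeight_eq_ciSup_arithmetic`, `bddAbove_range_borelHeight_arith_mul`, the BL spaces
import Summits.HodgeConjecture.HodgeConjecture.Theorems.K2E1BLHeightCosetsU3                           -- ★ BL-R1₃ (K2E1-p02): `exists_forall_borelHeight_mul_le` (`w₁` is attained, `N = 3`)
import Literature.NumberTheory.Automorphic.UnitaryGroupBorelConstantTermInvariance                      -- ★ `truncation_rational_mul` (`Λ^T` of a `G(F)`-invariant function is `G(F)`-invariant)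
import Literature.NumberTheory.Automorphic.UnitaryGroupTruncatedKernelHighCusp                          -- ★ `truncation_eq_self_sub_borelConstantTerm_of_rational_invariant` (`N = 3`)
import Summits.HodgeConjecture.HodgeConjecture.Theorems.K2E1TruncatedEisensteinL2                       -- ★ R6e (K2E4-p22): `truncation_apply_eq_self_of_forall_borelHeight_le`
import Mathlib.Analysis.Complex.AbsMax
import Mathlib.Analysis.Complex.Schwarz
import Mathlib.MeasureTheory.Function.ConvergenceInMeasure
import Mathlib.Topology.UniformSpace.UniformApproximation
import HarnessLib

/-!
# K2·E1 — `K2E1ContinuedEisensteinResidueFunctionUThree` ((RES) payer (P-cusp), part 1, `U(J₃)_{E/F}`): THE RESIDUE FUNCTION OF THE CONTINUED EISENSTEIN SERIES — UNIFORM BOUND NEAR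
# THE POLE, CONTINUITY, THE SIEGEL-TOP FORMULA FOR `Λ^T Ẽ(z)`, AND `Res_T = [Res Ẽ] − κ·[𝟙_{T<w₁}]` ALMOST EVERYWHERE

Track B ∕ K2-LIT, crux h413 = `stmt-HodgeConjecture-24833`, route of record `HCCMUnconditional`; cell `hodgecm-mathlib`, squad K2, ENGINE E1, campaign EIS-R7-BL-SPH-3 (R31).  Prover seat
`hodgecm-mathlib-K2E4-p10` (g6); RE-KEY (89) of the dealer K2E1-plan (g6).  THEOREMS ONLY (no `def`, no `instance`, no notation, no named-fact hypothesis, no `sorry`); lane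
`--supports stmt-HodgeConjecture-24833 --as helper` (count-neutral).  Closes no socket.  Rank-one unitary group `U(J₃)` over any CM-type extension `E/F` (generic `F E c`).

THE MATHEMATICS ([MoeglinWaldspurger1995, IV.1.11, I.2.13]; [Langlands1976, §7]).  Let `Ẽ : D × G(𝔸) → ℂ` be the continued Eisenstein values on an open `D ⊇ B(2,ρ)∖{2}`, holomorphic in `z`
((E1)), continuous in `g` ((E4)), locally bounded ((E2-bd)), with a SIMPLE POLE at `2`: `F g`, analytic at `2`, agrees with `(z−2)Ẽ(z)(g)` near `2` (the letter (F) of ★ p859418∕p859395).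
* §1 (complex analysis, any index set) `exists_forall_norm_le_of_isCompact_of_locally_bounded` (finite subcover), and for a family `Φ_g` holomorphic on a ball and bounded by `M` on the
  sphere: bounded by `M` on the closed ball (maximum modulus, Mathlib `Complex.norm_le_of_forall_mem_frontier_norm_le`) and `|Φ_g(z) − Φ_g(c)| ≤ (2M∕R)|z−c|` UNIFORMLY in `g` (Schwarz,
  Mathlib `Complex.dist_le_div_mul_dist_of_mapsTo_ball`) — so the centre values `g ↦ Φ_g(c)` are a UNIFORM limit of `g ↦ Φ_g(z)`, `z → c`.
* §2 (`U(J₃)`) **`exists_forall_norm_sub_mul_le_near_two`** — `‖(z−2)Ẽ(z)(g)‖ ≤ M_K` for `0 < |z−2| ≤ ρ∕2`, `g ∈ K` compact (the compact-uniform form of ★ p859395's `hbdd`);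
  **`continuous_residueValue`** — `g ↦ F g 2 = Res_{z=2}Ẽ(z)(g)` is CONTINUOUS on `G(𝔸)`; `residueValue_rational_mul` — and left-`G(F)`-invariant.
* §3 **`truncation_continued_apply`** — the SIEGEL-TOP FORMULA `Λ^T u(y) = u(y) − 𝟙[T < w(y)]·Φ(w(y))`, `w(y) = max_γ H(γy)`, for a left-`G(F)`-invariant `u` whose constant term is a
  function `Φ` of the height (`T ≥ 1`; ★ `truncation_rational_mul`, ★ `truncation_eq_self_sub_borelConstantTerm_of_rational_invariant`, ★ `exists_forall_borelHeight_mul_le`);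
  **`tendsto_sub_two_mul_truncation_continued`** — `(z−2)·Λ^T Ẽ(z)(y) → F y 2 − 𝟙[T < w(y)]·φ₀r` as `z → 2` (constant term `φ₀(H^z + c̃(z)H^{2−z})` with `(z−2)c̃(z) → r`).
* §4 **`ae_eq_residueValue_sub_indicator`** — if the operator road's `L²(μ)`-valued family `F_T(z) =ᵐ Λ^T Ẽ(z)` has `(z−2)•F_T(z) → Res_T` in `L²`, then
  `Res_T =ᵐ (x ↦ F x̃⁻¹ 2 − 𝟙[T < w₁ x]·φ₀r)` (`L²` limit ⟹ a.e. limit along a sequence, Mathlib `tendstoInMeasure_of_tendsto_Lp` ∘ `TendstoInMeasure.exists_seq_tendsto_ae'`).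
Consumer: ★ `K2E1SphericalEisensteinResidueCuspidalCMThree` (this seat): the continuous function `Res Ẽ − φ₀r` is a cusp form whose class is `Fres − φ₀r·𝟙`.
HONEST LABEL: HC_CM is proved only modulo the 7 printed citations (2 remaining named inputs: hLiu418 = `stmt-HodgeConjecture-24832`, h413 = `stmt-HodgeConjecture-24833`) until rung 0
closes; this file asserts no named fact and closes no socket; its heads are CONDITIONAL on the EXPORTS₃ letters (E1)(E4)(E2-bd)(E3′) and the pole letter (F).
References: [MoeglinWaldspurger1995] I.2.13, IV.1.11 · [Langlands1976] §7 · [Conway1978] IV §3, VI §1 (maximum modulus), VI §2 (Schwarz) · [BernsteinLapid2019] §4 p. 10.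
-/

set_option autoImplicit false
-- the mandated namespace repeats the single-problem summit's segment (`HodgeConjecture.HodgeConjecture`)
set_option linter.dupNamespace false

noncomputable section

open MeasureTheory Measure NumberField IsDedekindDomain Set Filter Topology Metric
open scoped ENNReal NNReal
open Literature.NumberTheory.Automorphic Literature.NumberTheory.Automorphic.UnitaryGroup AdelicGroupData
open Summit.HodgeConjecture.HodgeConjecture.Cruxes.H413.K2E1BLBorelSpacesU2Defs
open Summit.HodgeConjecture.HodgeConjecture.Cruxes.H413.K2E1BLEisensteinInWeightedSpaceU2Weights (supHeight_eq_ciSup_arithmetic)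
open Summit.HodgeConjecture.HodgeConjecture.Cruxes.H413.K2E1BLHeckeOperatorWeightedU2 (bddAbove_range_borelHeight_arith_mul)
open Summit.HodgeConjecture.HodgeConjecture.Cruxes.H413.K2E1BLHeightCosetsU3 (exists_forall_borelHeight_mul_le)
open Summit.HodgeConjecture.HodgeConjecture.Cruxes.H413.K2E1TruncatedEisensteinL2 (truncation_apply_eq_self_of_forall_borelHeight_le)

namespace Summit.HodgeConjecture.HodgeConjecture.Cruxes.H413.K2E1ContinuedEisensteinResidueFunctionUThree

/-! ## §1 Complex analysis: uniform bounds and uniform convergence at the centre of a ball for a bounded holomorphic family -/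

section Complex

variable {ι Y : Type*}

/-- **FINITE SUBCOVER**: a family `E : ℂ → Y → ℂ` locally bounded on `D × (compacts)` is bounded on `S × K` for `S ⊆ D` compact and `K` compact. [folklore] -/
theorem exists_forall_norm_le_of_isCompact_of_locally_bounded (E : ℂ → Y → ℂ) {D S : Set ℂ} (hS : IsCompact S) (hSD : S ⊆ D) {K : Set Y}
    (hbd : ∀ z₀ ∈ D, ∃ V ∈ 𝓝 z₀, ∃ M : ℝ, ∀ z ∈ V, ∀ g ∈ K, ‖E z g‖ ≤ M) :
    ∃ M : ℝ, ∀ z ∈ S, ∀ g ∈ K, ‖E z g‖ ≤ M := by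
  choose V hV M hM using fun z (hz : z ∈ S) => hbd z (hSD hz)
  obtain ⟨t, ht⟩ := hS.elim_nhds_subcover' V hV
  refine ⟨∑ x ∈ t, max (M x x.2) 0, fun z hz g hg => ?_⟩
  obtain ⟨x, hxt, hzx⟩ : ∃ x ∈ t, z ∈ V x x.2 := by simpa only [mem_iUnion, exists_prop] using ht hz
  calc ‖E z g‖ ≤ M x x.2 := hM x x.2 z hzx g hg
    _ ≤ max (M x x.2) 0 := le_max_left _ _
    _ ≤ ∑ x ∈ t, max (M x x.2) 0 := Finset.single_le_sum (f := fun x : ↥S => max (M x x.2) 0) (fun y _ => le_max_right _ _) hxt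

/-- **MAXIMUM MODULUS FOR A FAMILY**: if each `Φ g` (`g ∈ K`) is holomorphic on a neighbourhood of the closed ball `B̄(c,R)` (`R > 0`) and bounded by `M` on the sphere, then it is bounded by
`M` on the closed ball (Mathlib `Complex.norm_le_of_forall_mem_frontier_norm_le`). [cite: Conway1978, VI §1] -/
theorem norm_le_of_sphere_bound {Φ : ι → ℂ → ℂ} {K : Set ι} {c : ℂ} {R R' : ℝ} (hR : 0 < R) (hRR' : R < R') (hd : ∀ g ∈ K, DifferentiableOn ℂ (Φ g) (ball c R'))
    {M : ℝ} (hM : ∀ g ∈ K, ∀ w ∈ sphere c R, ‖Φ g w‖ ≤ M) : ∀ g ∈ K, ∀ z ∈ closedBall c R, ‖Φ g z‖ ≤ M := fun g hg z hz =>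
  Complex.norm_le_of_forall_mem_frontier_norm_le isBounded_ball ((hd g hg).diffContOnCl_ball (closedBall_subset_ball hRR'))
    (fun w hw => hM g hg w (by rwa [frontier_ball c hR.ne'] at hw)) (by rwa [closure_ball c hR.ne'])

/-- **UNIFORM CONVERGENCE AT THE CENTRE** (Schwarz): under the same hypotheses, `‖Φ g z − Φ g c‖ ≤ (2M∕R)·‖z − c‖` for `z ∈ B(c,R)`, uniformly in `g ∈ K`
(Mathlib `Complex.dist_le_div_mul_dist_of_mapsTo_ball`). [cite: Conway1978, VI §2] -/
theorem dist_le_of_sphere_bound {Φ : ι → ℂ → ℂ} {K : Set ι} {c : ℂ} {R R' : ℝ} (hR : 0 < R) (hRR' : R < R') (hd : ∀ g ∈ K, DifferentiableOn ℂ (Φ g) (ball c R'))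
    {M : ℝ} (hM : ∀ g ∈ K, ∀ w ∈ sphere c R, ‖Φ g w‖ ≤ M) : ∀ g ∈ K, ∀ z ∈ ball c R, dist (Φ g z) (Φ g c) ≤ 2 * M / R * dist z c := fun g hg z hz => by
  have hb := norm_le_of_sphere_bound hR hRR' hd hM g hg
  refine Complex.dist_le_div_mul_dist_of_mapsTo_ball ((hd g hg).mono (ball_subset_ball hRR'.le)) (fun w hw => ?_) hz
  rw [mem_closedBall, dist_eq_norm]
  calc ‖Φ g w - Φ g c‖ ≤ ‖Φ g w‖ + ‖Φ g c‖ := norm_sub_le _ _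
    _ ≤ M + M := add_le_add (hb w (ball_subset_closedBall hw)) (hb c (mem_closedBall_self hR.le))
    _ = 2 * M := by ring

/-- **THE CENTRE VALUES ARE A UNIFORM LIMIT**: `(z, g) ↦ Φ g z` converges to `g ↦ Φ g c` uniformly on `K` as `z → c`, `z ≠ c`. [cite: Conway1978, VI §2] -/
theorem tendstoUniformlyOn_of_sphere_bound {Φ : ι → ℂ → ℂ} {K : Set ι} {c : ℂ} {R R' : ℝ} (hR : 0 < R) (hRR' : R < R')
    (hd : ∀ g ∈ K, DifferentiableOn ℂ (Φ g) (ball c R')) {M : ℝ} (hM : ∀ g ∈ K, ∀ w ∈ sphere c R, ‖Φ g w‖ ≤ M) :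
    TendstoUniformlyOn (fun z g => Φ g z) (fun g => Φ g c) (𝓝[≠] c) K := by
  rcases K.eq_empty_or_nonempty with hK | hKne
  · rw [hK]; exact tendstoUniformlyOn_empty
  have hM0 : 0 ≤ M := by
    obtain ⟨w, hw⟩ : (sphere c R).Nonempty := (NormedSpace.sphere_nonempty (E := ℂ)).2 hR.le
    obtain ⟨g, hg⟩ := hKne
    exact (norm_nonneg _).trans (hM g hg w hw)
  rw [Metric.tendstoUniformlyOn_iff]
  intro ε hε
  have hδ : 0 < min R (ε * R / (2 * M + 1)) := lt_min hR (by positivity)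
  have hmem : ball c (min R (ε * R / (2 * M + 1))) ∈ 𝓝[≠] c := mem_nhdsWithin_of_mem_nhds (ball_mem_nhds _ hδ)
  filter_upwards [hmem] with z hz g hg
  rw [mem_ball] at hz
  have hzR : z ∈ ball c R := mem_ball.2 (hz.trans_le (min_le_left _ _))
  rw [dist_comm]
  calc dist (Φ g z) (Φ g c) ≤ 2 * M / R * dist z c := dist_le_of_sphere_bound hR hRR' hd hM g hg z hzR
    _ ≤ (2 * M + 1) / R * dist z c := by gcongr; linarith
    _ < (2 * M + 1) / R * (ε * R / (2 * M + 1)) := by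
        have h1 : 0 < (2 * M + 1) / R := by positivity
        exact mul_lt_mul_of_pos_left (hz.trans_le (min_le_right _ _)) h1
    _ = ε := by field_simp

end Complex

/-! ## §2 `U(J₃)`: the uniform bound near the pole and the continuity of the residue function -/

section Residue

variable {F E : Type} [Field F] [NumberField F] [Field E] [NumberField E] [Algebra F E] {c : E ≃ₐ[F] E}

/-- **THE POLE-FREE EXTENSION `Φ_g(z) = (z−2)Ẽ(z)(g)` (`z ≠ 2`), `Φ_g(2) = F g 2` IS HOLOMORPHIC ON `B(2,ρ)`** for every `g` (off `2` by (E1) on `D ⊇ B(2,ρ)∖{2}`; at `2` it agrees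
with the analytic `F g` near `2`). [cite: MoeglinWaldspurger1995, IV.1.11] -/
theorem differentiableOn_extension (Ec : ℂ → (quasiSplit F E c 3).Adelic → ℂ) {D : Set ℂ} (hDo : IsOpen D) {ρ : ℝ}
    (hρD : ∀ z : ℂ, z ≠ 2 → dist z 2 < ρ → z ∈ D) (hEd : ∀ g, DifferentiableOn ℂ (fun z => Ec z g) D)
    (Fp : (quasiSplit F E c 3).Adelic → ℂ → ℂ) (hF : ∀ g, AnalyticAt ℂ (Fp g) 2) (hFE : ∀ g, Fp g =ᶠ[𝓝[≠] 2] fun z => (z - 2) * Ec z g)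
    (g : (quasiSplit F E c 3).Adelic) :
    DifferentiableOn ℂ (fun z : ℂ => if z = 2 then Fp g 2 else (z - 2) * Ec z g) (ball 2 ρ) := by
  intro z hz
  by_cases h2 : z = 2
  · subst h2
    have hev : (fun z : ℂ => if z = 2 then Fp g 2 else (z - 2) * Ec z g) =ᶠ[𝓝 2] Fp g := by
      have h := eventually_nhdsWithin_iff.1 (hFE g)
      filter_upwards [h] with w hw
      by_cases hw2 : w = 2
      · rw [if_pos hw2, hw2]
      · rw [if_neg hw2, hw hw2]
    exact ((hF g).differentiableAt.congr_of_eventuallyEq hev).differentiableWithinAt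
  · have hzD : z ∈ D := hρD z h2 (mem_ball.1 hz)
    have hev : (fun z : ℂ => if z = 2 then Fp g 2 else (z - 2) * Ec z g) =ᶠ[𝓝 z] fun w => (w - 2) * Ec w g := by
      filter_upwards [isOpen_ne.mem_nhds h2] with w hw
      rw [if_neg hw]
    have hd : DifferentiableAt ℂ (fun w => (w - 2) * Ec w g) z :=
      ((differentiableAt_id.sub (differentiableAt_const _)).mul ((hEd g).differentiableAt (hDo.mem_nhds hzD)))
    exact (hd.congr_of_eventuallyEq hev).differentiableWithinAt

/-- **THE COMPACT-UNIFORM BOUND NEAR THE POLE**: for every compact `K ⊆ G(𝔸)` there is `M` with `‖(z−2)Ẽ(z)(g)‖ ≤ M` for `0 < |z−2| ≤ ρ∕2`, `g ∈ K`, and `‖F g 2‖ ≤ M` — maximum modulus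
on `B̄(2,ρ∕2)` from the bound on the sphere supplied by (E2-bd) (finite subcover of the compact sphere ⊆ `D`). [cite: MoeglinWaldspurger1995, IV.1.11] [cite: Conway1978, VI §1] -/
theorem exists_forall_norm_sub_mul_le_near_two (Ec : ℂ → (quasiSplit F E c 3).Adelic → ℂ) {D : Set ℂ} (hDo : IsOpen D) {ρ : ℝ} (hρ : 0 < ρ)
    (hρD : ∀ z : ℂ, z ≠ 2 → dist z 2 < ρ → z ∈ D) (hEd : ∀ g, DifferentiableOn ℂ (fun z => Ec z g) D)
    (hEbd : ∀ z₀ ∈ D, ∀ K : Set (quasiSplit F E c 3).Adelic, IsCompact K → ∃ V ∈ 𝓝 z₀, ∃ M : ℝ, ∀ z ∈ V, ∀ g ∈ K, ‖Ec z g‖ ≤ M)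
    (Fp : (quasiSplit F E c 3).Adelic → ℂ → ℂ) (hF : ∀ g, AnalyticAt ℂ (Fp g) 2) (hFE : ∀ g, Fp g =ᶠ[𝓝[≠] 2] fun z => (z - 2) * Ec z g)
    {K : Set (quasiSplit F E c 3).Adelic} (hK : IsCompact K) :
    ∃ M : ℝ, (∀ g ∈ K, ∀ w ∈ sphere (2 : ℂ) (ρ / 2), ‖(if w = 2 then Fp g 2 else (w - 2) * Ec w g)‖ ≤ M) ∧
      (∀ g ∈ K, ∀ z : ℂ, z ≠ 2 → dist z 2 ≤ ρ / 2 → ‖(z - 2) * Ec z g‖ ≤ M) ∧ ∀ g ∈ K, ‖Fp g 2‖ ≤ M := by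
  have hS : IsCompact (sphere (2 : ℂ) (ρ / 2)) := isCompact_sphere _ _
  have hSD : sphere (2 : ℂ) (ρ / 2) ⊆ D := fun w hw => by
    have hw' : dist w 2 = ρ / 2 := hw
    refine hρD w (fun h => ?_) (by rw [hw']; linarith)
    rw [h, dist_self] at hw'
    linarith
  obtain ⟨M₀, hM₀⟩ := exists_forall_norm_le_of_isCompact_of_locally_bounded Ec hS hSD fun z₀ hz₀ => hEbd z₀ hz₀ K hK
  set M : ℝ := ρ / 2 * max M₀ 0 with hM
  have hsphere : ∀ g ∈ K, ∀ w ∈ sphere (2 : ℂ) (ρ / 2), ‖(if w = 2 then Fp g 2 else (w - 2) * Ec w g)‖ ≤ M := fun g hg w hw => by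
    have hw' : dist w 2 = ρ / 2 := hw
    have hw2 : w ≠ 2 := fun h => by rw [h, dist_self] at hw'; linarith
    rw [if_neg hw2, norm_mul, ← dist_eq_norm, hw', hM]
    exact mul_le_mul_of_nonneg_left ((hM₀ w hw g hg).trans (le_max_left _ _)) (by linarith)
  have hball := norm_le_of_sphere_bound (half_pos hρ) (half_lt_self hρ) (fun g _ => differentiableOn_extension Ec hDo hρD hEd Fp hF hFE g) hsphere
  refine ⟨M, hsphere, fun g hg z hz2 hz => ?_, fun g hg => ?_⟩
  · have h := hball g hg z (mem_closedBall.2 hz)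
    rwa [if_neg hz2] at h
  · have h := hball g hg 2 (mem_closedBall_self (by linarith))
    rwa [if_pos rfl] at h

variable [MeasurableSpace (quasiSplit F E c 3).Adelic] [BorelSpace (quasiSplit F E c 3).Adelic]

omit [MeasurableSpace (quasiSplit F E c 3).Adelic] [BorelSpace (quasiSplit F E c 3).Adelic] in
/-- **THE RESIDUE FUNCTION `g ↦ F g 2 = Res_{z=2} Ẽ(z)(g)` IS CONTINUOUS ON `G(𝔸)`**: on every compact `K` it is the UNIFORM limit (§1, Schwarz) of the continuous functions
`g ↦ (z−2)Ẽ(z)(g)` ((E4)), `z → 2`; `G(𝔸)` is locally compact. [cite: MoeglinWaldspurger1995, IV.1.11] [cite: Conway1978, VI §2] -/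
theorem continuous_residueValue (Ec : ℂ → (quasiSplit F E c 3).Adelic → ℂ) {D : Set ℂ} (hDo : IsOpen D) {ρ : ℝ} (hρ : 0 < ρ)
    (hρD : ∀ z : ℂ, z ≠ 2 → dist z 2 < ρ → z ∈ D) (hEd : ∀ g, DifferentiableOn ℂ (fun z => Ec z g) D) (hE4 : ∀ z ∈ D, Continuous (Ec z))
    (hEbd : ∀ z₀ ∈ D, ∀ K : Set (quasiSplit F E c 3).Adelic, IsCompact K → ∃ V ∈ 𝓝 z₀, ∃ M : ℝ, ∀ z ∈ V, ∀ g ∈ K, ‖Ec z g‖ ≤ M)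
    (Fp : (quasiSplit F E c 3).Adelic → ℂ → ℂ) (hF : ∀ g, AnalyticAt ℂ (Fp g) 2) (hFE : ∀ g, Fp g =ᶠ[𝓝[≠] 2] fun z => (z - 2) * Ec z g) :
    Continuous fun g : (quasiSplit F E c 3).Adelic => Fp g 2 := by
  haveI := t2Space_adeleRing_of_numberField E
  haveI := locallyCompactSpace_adeleRing' E
  haveI : LocallyCompactSpace (quasiSplit F E c 3).Adelic := inferInstanceAs (LocallyCompactSpace (adelic F E c 3 ((StdForm.antidiagonal 3).over E)))
  refine continuous_iff_continuousAt.2 fun g₀ => ?_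
  obtain ⟨K, hK, hKg₀⟩ := exists_compact_mem_nhds g₀
  obtain ⟨M, hsphere, -, -⟩ := exists_forall_norm_sub_mul_le_near_two Ec hDo hρ hρD hEd hEbd Fp hF hFE hK
  have hunif := tendstoUniformlyOn_of_sphere_bound (half_pos hρ) (half_lt_self hρ)
    (fun g _ => differentiableOn_extension Ec hDo hρD hEd Fp hF hFE g) hsphere
  -- each approximant `g ↦ (z−2)Ẽ(z)(g)` is continuous for `z ∈ D`, and `z ∈ D` frequently along `𝓝[≠] 2`
  have hfreq : ∃ᶠ z in 𝓝[≠] (2 : ℂ), ContinuousOn (fun g : (quasiSplit F E c 3).Adelic => if z = 2 then Fp g 2 else (z - 2) * Ec z g) K := by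
    refine Filter.Eventually.frequently ?_
    have hmem : {z : ℂ | z ≠ 2} ∩ ball (2 : ℂ) ρ ∈ 𝓝[≠] (2 : ℂ) := inter_mem_nhdsWithin _ (ball_mem_nhds _ hρ)
    filter_upwards [hmem] with z hz
    have hz2 : z ≠ 2 := hz.1
    have hzD : z ∈ D := hρD z hz2 (mem_ball.1 hz.2)
    simp only [if_neg hz2]
    exact (continuous_const.mul (hE4 z hzD)).continuousOn
  have hcont := hunif.continuousOn hfreq
  exact (hcont.congr fun g _ => (if_pos rfl).symm).continuousAt hKg₀

omit [MeasurableSpace (quasiSplit F E c 3).Adelic] [BorelSpace (quasiSplit F E c 3).Adelic] in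
/-- **THE RESIDUE FUNCTION IS LEFT-`G(F)`-INVARIANT** (the pole values of `(z−2)Ẽ(z)(γg) = (z−2)Ẽ(z)(g)` agree: limits along `𝓝[≠] 2` are unique). [cite: MoeglinWaldspurger1995, IV.1.11] -/
theorem residueValue_rational_mul (Ec : ℂ → (quasiSplit F E c 3).Adelic → ℂ) {D : Set ℂ} (hD2 : ∀ᶠ z in 𝓝[≠] (2 : ℂ), z ∈ D)
    (hEcinv : ∀ z ∈ D, ∀ (γ : (quasiSplit F E c 3).arithmeticSubgroup) (x : (quasiSplit F E c 3).Adelic), Ec z ((γ : (quasiSplit F E c 3).Adelic) * x) = Ec z x)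
    (Fp : (quasiSplit F E c 3).Adelic → ℂ → ℂ) (hF : ∀ g, AnalyticAt ℂ (Fp g) 2) (hFE : ∀ g, Fp g =ᶠ[𝓝[≠] 2] fun z => (z - 2) * Ec z g)
    (γ : (quasiSplit F E c 3).arithmeticSubgroup) (x : (quasiSplit F E c 3).Adelic) : Fp ((γ : (quasiSplit F E c 3).Adelic) * x) 2 = Fp x 2 := by
  have h1 : Tendsto (Fp ((γ : (quasiSplit F E c 3).Adelic) * x)) (𝓝[≠] 2) (𝓝 (Fp ((γ : (quasiSplit F E c 3).Adelic) * x) 2)) :=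
    tendsto_nhdsWithin_of_tendsto_nhds (hF _).continuousAt.tendsto
  have h2 : Tendsto (Fp x) (𝓝[≠] 2) (𝓝 (Fp x 2)) := tendsto_nhdsWithin_of_tendsto_nhds (hF _).continuousAt.tendsto
  have heq : Fp ((γ : (quasiSplit F E c 3).Adelic) * x) =ᶠ[𝓝[≠] 2] Fp x := by
    filter_upwards [hFE _, hFE x, hD2] with z hz1 hz2 hzD
    rw [hz1, hz2, hEcinv z hzD γ x]
  exact tendsto_nhds_unique (h1.congr' heq) h2

end Residue

/-! ## §3 The Siegel-top formula for `Λ^T` and the pointwise limit of `(z−2)·Λ^T Ẽ(z)` -/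

section SiegelTop

variable {F E : Type} [Field F] [NumberField F] [Field E] [NumberField E] [Algebra F E] {c : E ≃ₐ[F] E}
variable [MeasurableSpace (quasiSplit F E c 3).Adelic] [BorelSpace (quasiSplit F E c 3).Adelic]

/-- **THE SIEGEL-TOP FORMULA**: for `T ≥ 1`, a left-`G(F)`-invariant `u` whose constant term is a function of the height, `u_B(g) = Φ(H(g))`, and every `y`:
`Λ^T u(y) = u(y) − 𝟙[T < w(y)]·Φ(w(y))`, `w(y) = max_{γ ∈ G(F)} H(γy)` (attained ★; above the floor only the top coset contributes ★, below it nothing does ★).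
[cite: MoeglinWaldspurger1995, I.2.13] [cite: Garrett2018, §2.10–§2.11] -/
theorem truncation_continued_apply (ν : Measure ↥(adelicUnipotent F E c 3)) [ν.IsHaarMeasure] {𝓕 : Set ↥(adelicUnipotent F E c 3)}
    (h𝓕 : IsFundamentalDomain ↥(rationalUnipotent F E c 3) 𝓕 ν) {T : ℝ≥0} (hT : 1 ≤ T) {u : (quasiSplit F E c 3).Adelic → ℂ}
    (hu : ∀ (γ : (quasiSplit F E c 3).arithmeticSubgroup) (x : (quasiSplit F E c 3).Adelic), u ((γ : (quasiSplit F E c 3).Adelic) * x) = u x)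
    {Φ : ℝ≥0 → ℂ} (hCT : ∀ g : (quasiSplit F E c 3).Adelic, borelConstantTerm ν 𝓕 u g = Φ (borelHeight g)) (y : (quasiSplit F E c 3).Adelic) :
    truncation ν 𝓕 T u y = u y - if T < ⨆ γ : (quasiSplit F E c 3).arithmeticSubgroup, borelHeight ((γ : (quasiSplit F E c 3).Adelic) * y) then
      Φ (⨆ γ : (quasiSplit F E c 3).arithmeticSubgroup, borelHeight ((γ : (quasiSplit F E c 3).Adelic) * y)) else 0 := by
  obtain ⟨γ₀, hγ₀⟩ := exists_forall_borelHeight_mul_le (F := F) (E := E) (c := c) y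
  have hW : (⨆ γ : (quasiSplit F E c 3).arithmeticSubgroup, borelHeight ((γ : (quasiSplit F E c 3).Adelic) * y)) = borelHeight ((γ₀ : (quasiSplit F E c 3).Adelic) * y) :=
    le_antisymm (ciSup_le hγ₀) (le_ciSup (bddAbove_range_borelHeight_arith_mul y) γ₀)
  rw [hW]
  by_cases h : T < borelHeight ((γ₀ : (quasiSplit F E c 3).Adelic) * y)
  · rw [if_pos h, ← truncation_rational_mul ν h𝓕 T hu γ₀ y, truncation_eq_self_sub_borelConstantTerm_of_rational_invariant ν h𝓕 hu hT h, hu, hCT]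
  · rw [if_neg h, sub_zero]
    exact truncation_apply_eq_self_of_forall_borelHeight_le ν 𝓕 u fun δ => (hγ₀ δ).trans (not_lt.1 h)

/-- **THE POINTWISE LIMIT `(z−2)·Λ^T Ẽ(z)(y) → F y 2 − 𝟙[T < w(y)]·φ₀r`** (`z → 2`, `z ≠ 2`): the Siegel-top formula with the continued constant term `φ₀(H^z + c̃(z)H^{2−z})` ((E3′)),
`(z−2)Ẽ(z)(y) = F y z → F y 2` (the pole letter), `(z−2)H^z → 0`, `(z−2)c̃(z) → r`, `H^{2−z} → 1`. [cite: MoeglinWaldspurger1995, IV.1.11] [cite: Langlands1976, §7] -/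
theorem tendsto_sub_two_mul_truncation_continued (ν : Measure ↥(adelicUnipotent F E c 3)) [ν.IsHaarMeasure] {𝓕 : Set ↥(adelicUnipotent F E c 3)}
    (h𝓕 : IsFundamentalDomain ↥(rationalUnipotent F E c 3) 𝓕 ν) {T : ℝ≥0} (hT : 1 ≤ T) (φ₀ : ℂ)
    (Ec : ℂ → (quasiSplit F E c 3).Adelic → ℂ) {D : Set ℂ} (hD2 : ∀ᶠ z in 𝓝[≠] (2 : ℂ), z ∈ D)
    (hEcinv : ∀ z ∈ D, ∀ (γ : (quasiSplit F E c 3).arithmeticSubgroup) (x : (quasiSplit F E c 3).Adelic), Ec z ((γ : (quasiSplit F E c 3).Adelic) * x) = Ec z x)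
    {cc : ℂ → ℂ} {r : ℂ} (hcres : Tendsto (fun z : ℂ => (z - 2) * cc z) (𝓝[≠] 2) (𝓝 r))
    (hE3 : ∀ z ∈ D, ∀ g : (quasiSplit F E c 3).Adelic,
      borelConstantTerm ν 𝓕 (Ec z) g = φ₀ * ((((borelHeight g : ℝ≥0) : ℝ) : ℂ) ^ z + cc z * (((borelHeight g : ℝ≥0) : ℝ) : ℂ) ^ (2 - z)))
    (Fp : (quasiSplit F E c 3).Adelic → ℂ → ℂ) (hF : ∀ g, AnalyticAt ℂ (Fp g) 2) (hFE : ∀ g, Fp g =ᶠ[𝓝[≠] 2] fun z => (z - 2) * Ec z g)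
    (y : (quasiSplit F E c 3).Adelic) :
    Tendsto (fun z : ℂ => (z - 2) * truncation ν 𝓕 T (Ec z) y) (𝓝[≠] 2)
      (𝓝 (Fp y 2 - if T < ⨆ γ : (quasiSplit F E c 3).arithmeticSubgroup, borelHeight ((γ : (quasiSplit F E c 3).Adelic) * y) then φ₀ * r else 0)) := by
  set W : ℝ≥0 := ⨆ γ : (quasiSplit F E c 3).arithmeticSubgroup, borelHeight ((γ : (quasiSplit F E c 3).Adelic) * y) with hWdef
  -- the Siegel-top formula along the filter
  have heq : (fun z : ℂ => (z - 2) * truncation ν 𝓕 T (Ec z) y) =ᶠ[𝓝[≠] 2] fun z =>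
      Fp y z - if T < W then φ₀ * ((z - 2) * (((W : ℝ≥0) : ℝ) : ℂ) ^ z) + φ₀ * ((z - 2) * cc z) * (((W : ℝ≥0) : ℝ) : ℂ) ^ (2 - z) else 0 := by
    filter_upwards [hD2, hFE y] with z hzD hzF
    rw [truncation_continued_apply ν h𝓕 hT (hEcinv z hzD) (Φ := fun t => φ₀ * ((((t : ℝ≥0) : ℝ) : ℂ) ^ z + cc z * (((t : ℝ≥0) : ℝ) : ℂ) ^ (2 - z))) (fun g => hE3 z hzD g) y,
      hzF, mul_sub]
    congr 1
    split_ifs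
    · ring
    · rw [mul_zero]
  refine Tendsto.congr' heq.symm ?_
  have hF2 : Tendsto (Fp y) (𝓝[≠] 2) (𝓝 (Fp y 2)) := tendsto_nhdsWithin_of_tendsto_nhds (hF y).continuousAt.tendsto
  refine hF2.sub ?_
  split_ifs with hTW
  · -- `W > T ≥ 1 > 0`
    have hW0 : (((W : ℝ≥0) : ℝ) : ℂ) ≠ 0 := by
      have : (0 : ℝ≥0) < W := lt_of_lt_of_le (zero_lt_one.trans_le hT) hTW.le
      exact_mod_cast this.ne'
    have hcpow : ContinuousAt (fun z : ℂ => (((W : ℝ≥0) : ℝ) : ℂ) ^ z) 2 := (continuousAt_const_cpow hW0)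
    have h1 : Tendsto (fun z : ℂ => φ₀ * ((z - 2) * (((W : ℝ≥0) : ℝ) : ℂ) ^ z)) (𝓝[≠] 2) (𝓝 (φ₀ * (0 * (((W : ℝ≥0) : ℝ) : ℂ) ^ (2 : ℂ)))) := by
      refine tendsto_nhdsWithin_of_tendsto_nhds (Tendsto.const_mul φ₀ (Tendsto.mul ?_ hcpow.tendsto))
      have : Tendsto (fun z : ℂ => z - 2) (𝓝 2) (𝓝 (2 - 2)) := tendsto_id.sub tendsto_const_nhds
      rwa [sub_self] at this
    have h2 : Tendsto (fun z : ℂ => φ₀ * ((z - 2) * cc z) * (((W : ℝ≥0) : ℝ) : ℂ) ^ (2 - z)) (𝓝[≠] 2) (𝓝 (φ₀ * r * (((W : ℝ≥0) : ℝ) : ℂ) ^ ((2 : ℂ) - 2))) := by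
      refine ((hcres.const_mul φ₀)).mul (tendsto_nhdsWithin_of_tendsto_nhds ?_)
      exact ((continuousAt_const_cpow hW0).comp_of_eq (continuousAt_const.sub continuousAt_id) rfl).tendsto
    have h := h1.add h2
    simp only [zero_mul, mul_zero, zero_add, sub_self, Complex.cpow_zero, mul_one] at h
    exact h
  · exact tendsto_const_nhds

end SiegelTop

/-! ## §4 The `L²` residue class is the residue function minus the Siegel indicator, almost everywhere -/

section AE

variable {F E : Type} [Field F] [NumberField F] [Field E] [NumberField E] [Algebra F E] {c : E ≃ₐ[F] E}
variable [MeasurableSpace (quasiSplit F E c 3).Adelic] [BorelSpace (quasiSplit F E c 3).Adelic]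

/-- **`Res_T =ᵐ Res Ẽ − κ·𝟙_{T<w₁}`**: if `F_T : ℂ → L²(μ)` satisfies `F_T(z) =ᵐ Λ^T Ẽ(z)` on `D` and `(z−2)•F_T(z) → Res_T` in `L²(μ)` (`z → 2`, `z ≠ 2`), then for `μ`-a.e. `x = [g]`:
`Res_T(x) = F g̃⁻¹ 2 − 𝟙[T < w₁(x)]·φ₀r` — an `L²` limit is an a.e. limit along a sequence (Mathlib `tendstoInMeasure_of_tendsto_Lp`, `TendstoInMeasure.exists_seq_tendsto_ae'`), and the
pointwise limit is §3. [cite: MoeglinWaldspurger1995, IV.1.11] [cite: BernsteinLapid2019, §4 p. 10] -/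
theorem ae_eq_residueValue_sub_indicator (μ : Measure (quasiSplit F E c 3).automorphicQuotient)
    (ν : Measure ↥(adelicUnipotent F E c 3)) [ν.IsHaarMeasure] {𝓕 : Set ↥(adelicUnipotent F E c 3)}
    (h𝓕 : IsFundamentalDomain ↥(rationalUnipotent F E c 3) 𝓕 ν) {T : ℝ≥0} (hT : 1 ≤ T) (φ₀ : ℂ)
    (Ec : ℂ → (quasiSplit F E c 3).Adelic → ℂ) {D : Set ℂ} (hD2 : ∀ᶠ z in 𝓝[≠] (2 : ℂ), z ∈ D)
    (hEcinv : ∀ z ∈ D, ∀ (γ : (quasiSplit F E c 3).arithmeticSubgroup) (x : (quasiSplit F E c 3).Adelic), Ec z ((γ : (quasiSplit F E c 3).Adelic) * x) = Ec z x)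
    {cc : ℂ → ℂ} {r : ℂ} (hcres : Tendsto (fun z : ℂ => (z - 2) * cc z) (𝓝[≠] 2) (𝓝 r))
    (hE3 : ∀ z ∈ D, ∀ g : (quasiSplit F E c 3).Adelic,
      borelConstantTerm ν 𝓕 (Ec z) g = φ₀ * ((((borelHeight g : ℝ≥0) : ℝ) : ℂ) ^ z + cc z * (((borelHeight g : ℝ≥0) : ℝ) : ℂ) ^ (2 - z)))
    (Fp : (quasiSplit F E c 3).Adelic → ℂ → ℂ) (hF : ∀ g, AnalyticAt ℂ (Fp g) 2) (hFE : ∀ g, Fp g =ᶠ[𝓝[≠] 2] fun z => (z - 2) * Ec z g)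
    (Fam : ℂ → (quasiSplit F E c 3).L2 μ)
    (hFam : ∀ z ∈ D, ((Fam z : (quasiSplit F E c 3).L2 μ) : (quasiSplit F E c 3).automorphicQuotient → ℂ) =ᵐ[μ] (quasiSplit F E c 3).quotFun (truncation ν 𝓕 T (Ec z)))
    (Res : (quasiSplit F E c 3).L2 μ) (hRes : Tendsto (fun z : ℂ => (z - 2) • Fam z) (𝓝[≠] 2) (𝓝 Res)) :
    ((Res : (quasiSplit F E c 3).L2 μ) : (quasiSplit F E c 3).automorphicQuotient → ℂ) =ᵐ[μ] fun x =>
      Fp (Quotient.out (x : (quasiSplit F E c 3).Adelic ⧸ (quasiSplit F E c 3).quotientSubgroup))⁻¹ 2 -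
        if T < supHeight F E c 3 x then φ₀ * r else 0 := by
  -- an a.e.-convergent sequence `zₙ → 2`, `zₙ ≠ 2`
  have hIM := tendstoInMeasure_of_tendsto_Lp hRes
  obtain ⟨ns, hns, hae⟩ := hIM.exists_seq_tendsto_ae'
  -- eventually `zₙ ∈ D`; along those `n` the representatives are `(zₙ−2)·Λ^T Ẽ(zₙ)` a.e.
  have hnsD : ∀ᶠ n in atTop, ns n ∈ D := hns.eventually hD2
  have hrep : ∀ᵐ x ∂μ, ∀ n, ns n ∈ D → (((ns n - 2) • Fam (ns n) : (quasiSplit F E c 3).L2 μ) : (quasiSplit F E c 3).automorphicQuotient → ℂ) x =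
      (ns n - 2) * (quasiSplit F E c 3).quotFun (truncation ν 𝓕 T (Ec (ns n))) x := by
    rw [ae_all_iff]
    intro n
    by_cases hn : ns n ∈ D
    · filter_upwards [Lp.coeFn_smul (ns n - 2) (Fam (ns n)), hFam (ns n) hn] with x hx hx'
      intro _
      rw [hx, Pi.smul_apply, hx', smul_eq_mul]
    · exact ae_of_all _ fun x h => absurd h hn
  filter_upwards [hae, hrep] with x hx hxrep
  set y : (quasiSplit F E c 3).Adelic := (Quotient.out (x : (quasiSplit F E c 3).Adelic ⧸ (quasiSplit F E c 3).quotientSubgroup))⁻¹ with hy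
  -- the pointwise limit along the sequence (§3 composed with `ns`)
  have hpt := (tendsto_sub_two_mul_truncation_continued ν h𝓕 hT φ₀ Ec hD2 hEcinv hcres hE3 Fp hF hFE y).comp hns
  have hW : (⨆ γ : (quasiSplit F E c 3).arithmeticSubgroup, borelHeight ((γ : (quasiSplit F E c 3).Adelic) * y)) = supHeight F E c 3 x := by
    rw [supHeight_eq_ciSup_arithmetic]
  rw [hW] at hpt
  have hev : (fun n => (((ns n - 2) • Fam (ns n) : (quasiSplit F E c 3).L2 μ) : (quasiSplit F E c 3).automorphicQuotient → ℂ) x) =ᶠ[atTop]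
      ((fun z : ℂ => (z - 2) * truncation ν 𝓕 T (Ec z) y) ∘ ns) := by
    filter_upwards [hnsD] with n hn
    rw [hxrep n hn]
    rfl
  exact tendsto_nhds_unique (hx.congr' hev) hpt

end AE

end Summit.HodgeConjecture.HodgeConjecture.Cruxes.H413.K2E1ContinuedEisensteinResidueFunctionUThree

end
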